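/-
Copyright (c) 2026 the pub-hodgecm-mathlib formalisation cell (harness21).  Prover seat hodgecm-mathlib-F0P2-p08 (g0) (re-dealt to L1 `stub_firstTermThetaPairing` by
director s1970; LEAD F0P6-plan (g14) slot `p19`): Track B «K2-LIT», hLiu418 = stmt-HodgeConjecture-24832, road `K2_Liu`, socket #42S, organ S4, (asm-3G) letter (G-Kfin):
A PRODUCT `h ↦ A(h_∞)·B(h_f)` OF A `K_∞`-FINITE ARCHIMEDEAN FACTOR AND A FINITE-ADELIC FACTOR OF OPEN LEVEL IS `K`-FINITE (★ `IsKFinite 𝒦`) — the global packaging of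
★ p861127 `K2LiuLocalSWSectionKFinite` §1.
-/
import Summits.HodgeConjecture.HodgeConjecture.Theorems.K2LiuLocalSWSectionKFinite   -- ★ p861127 (L-Kfin) §1: `finite_image_rightTranslate_of_isCompact`, ★ p861068 §1 `continuous_of_forall_mul_eq`
import Summits.HodgeConjecture.HodgeConjecture.Theorems.K2LiuArchSWSpanningDefs        -- ★ S2 DEFS: `IsArchKFinite 𝒦 A` (the `K_∞`-finite currency of organ S2∕S3)
import Literature.NumberTheory.K2Lit.SiegelStandardIwasawaData                         -- ★ J1(a): `IwasawaDatum.IsStd`, `IsStd.exists_arch`; brings ★ D1′ `IwasawaDatum`, `IsKFinite`, `rightTranslateSpan`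
import Literature.NumberTheory.Automorphic.UnitaryGroupAdelicProduct                    -- ★ U2: `archPart`, `finPart`, `archToAdelic`, continuity
import Mathlib.RingTheory.Finiteness.Bilinear
import HarnessLib

/-!
# Crux `HLiu418`, road `K2_Liu`, socket #42S, organ S4, (asm-3G) letter (G-Kfin): an archimedean × finite product of open finite level is `K`-finite

Cell `hodgecm-mathlib`, crux item hLiu418 = `stmt-HodgeConjecture-24832`; squad K2 ∕ K2Liu (L1 `stub_firstTermThetaPairing`, LEAD F0P6-plan (g14)); prover F0P2-p08 (g0).
THEOREMS ONLY (no `def`, no instance, no notation, no named-fact hypothesis, no `sorry`); lane `--supports stmt-HodgeConjecture-24832 --as helper`.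

THE LETTER.  For an Iwasawa datum `𝒦` of `H(𝔸)` (★ D1′ `IwasawaDatum`: `𝒦.K` COMPACT), a function of the shape `φ(h) = A(h_∞) · B(h_f)` (`h_∞ = archPart h ∈ H_∞`, `h_f = finPart h ∈ H(𝔸_f)`,
★ U2 `UnitaryGroup.archPart ∕ finPart`) whose archimedean factor `A` is `K_∞`-finite — the right translates `x ↦ A(x · k_∞)`, `k ∈ 𝒦.K`, span a finite-dimensional space — and whose
finite factor `B` has an OPEN level `U_f ≤ H(𝔸_f)` (`B(y u) = B(y)`, `u ∈ U_f`) is `K`-FINITE: `IsKFinite 𝒦 φ` (★ D1′).  No `IsStd` is needed: `archPart`∕`finPart` are homomorphisms on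
all of `H(𝔸)`, the finite factor has only finitely many right translates over the COMPACT set `finPart(𝒦.K)` (★ p861127 §1 `finite_image_rightTranslate_of_isCompact`), and the right
`𝒦.K`-translates of `φ` lie in the image `map₂ P V_A V_B` of the two finite-dimensional spans under the bilinear «pull back and multiply» map
`P f g := h ↦ f(h_∞)·g(h_f)` (Mathlib `Submodule.FG.map₂`).  For a STANDARD datum (★ J1(a) `IsStd`: `𝒦.K = C_∞·C_f`) the archimedean input is equivalently ★ S2 DEFS' `IsArchKFinite 𝒦 A` (a finite-dimensional space `V ∋ A` of
functions on `H_∞` stable under the right translations by the purely archimedean elements of `𝒦.K`).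
THE CONSUMER (K2Liu-p03 (g7)'s G2 `K2LiuIncoherentPatternFamily`, (asm-3G) (P2)): the INCOHERENT pure pattern products `h ↦ G_∞(h_∞, Φ_∞) · (∏_{v∈S′} b_v(h_v) · ∏ᶠ_{v∉S′} Λ_v(h_v))`
(`b_v ∈ R(V′_v)` of open level by ★ p861068, `Λ_v` spherical) are `K`-finite for a standard `𝒦` — `A := G_∞(·, Φ_∞)` from the archimedean realiser datum, `B :=` the finite product with
level `∏_{v∈S′} U_v × ∏_{v∉S′} K_v`.
* §1 (generic bilinear bookkeeping, any commutative ring `R`, any groups): `span_range_mul_comp_le_map₂` — the right translates of `h ↦ A(a h)·B(b h)` along homomorphisms `a`, `b` lie in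
  `map₂ P (span {A(· a k)}) (span {B(· b k)})`; `finite_span_range_mul_comp` — hence their span is finitely generated when the two factor spans are.
* §2 `isKFinite_archMul_fin` (any `𝒦`), `continuous_archMul_fin`; §3 `isKFinite_archMul_fin_of_isArchKFinite` (`𝒦` standard, arch input = ★ `IsArchKFinite 𝒦 A`).
[BorelJacquet1979, §4.1 (admissibility; `G(𝔸) = G_∞ × G(𝔸_f)`, `K`-finiteness)]; [HarrisKudlaSweet1996, §1 (1.15)–(1.17)]; [KudlaRallis1994, §1]; [Tan1999, §1 p. 166].
HONEST LABEL.  Count-neutral helper: `HC_CM` is proved only modulo the 7 printed citations (2 remaining named inputs: hLiu418 = `stmt-HodgeConjecture-24832`,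
h413 = `stmt-HodgeConjecture-24833`) until rung 0 closes.
-/

set_option autoImplicit false
set_option linter.dupNamespace false -- the mandated namespace repeats `HodgeConjecture.HodgeConjecture`

noncomputable section

open scoped Matrix
open NumberField IsDedekindDomain Topology
open Literature.NumberTheory.Automorphic Literature.NumberTheory.Automorphic.UnitaryGroup Literature.NumberTheory.GaloisRepresentations
open Literature.NumberTheory.GelbartRogawski1991 Literature.NumberTheory.GelbartRogawski1991.GRConstruction
open Literature.NumberTheory.K2Lit.SiegelDoubled
open Summit.HodgeConjecture.HodgeConjecture.Cruxes.HLiu418.K2LiuLocalSWSectionSmooth (continuous_of_forall_mul_eq)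
open Summit.HodgeConjecture.HodgeConjecture.Cruxes.HLiu418.K2LiuLocalSWSectionKFinite (finite_image_rightTranslate_of_isCompact)
open Summit.HodgeConjecture.HodgeConjecture.Cruxes.HLiu418.K2LiuArchSWSpanningDefs (IsArchKFinite)

namespace Summit.HodgeConjecture.HodgeConjecture.Cruxes.HLiu418.K2LiuArchFinProductKFinite

/-! ## §1 Bilinear bookkeeping: translates of a product of two pulled-back factors -/

/-- **translates of `h ↦ A(a h) · B(b h)` lie in `map₂ P V_A V_B`**: for homomorphisms `a : G →* Gα`, `b : G →* Gβ`, functions `A`, `B` and the bilinear «pull back and multiply»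
map `P`, every right translate `h ↦ A(a(h k))·B(b(h k))`, `k ∈ K`, lies in `Submodule.map₂ P (span {x ↦ A(x · a k)}_{k∈K}) (span {y ↦ B(y · b k)}_{k∈K})`. [folklore]
[cite: BorelJacquet1979, §4.1] -/
theorem span_range_mul_comp_le_map₂ {R : Type*} [CommRing R] {G Gα Gβ : Type*} [Group G] [Group Gα] [Group Gβ] (a : G →* Gα) (b : G →* Gβ) (A : Gα → R) (B : Gβ → R)
    (K : Set G) (P : (Gα → R) →ₗ[R] (Gβ → R) →ₗ[R] (G → R)) (hP : ∀ (f : Gα → R) (g : Gβ → R) (h : G), P f g h = f (a h) * g (b h)) :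
    Submodule.span R (Set.range fun k : K => fun h : G => A (a (h * (k : G))) * B (b (h * (k : G)))) ≤
      Submodule.map₂ P (Submodule.span R (Set.range fun k : K => fun x : Gα => A (x * a (k : G))))
        (Submodule.span R (Set.range fun k : K => fun y : Gβ => B (y * b (k : G)))) := by
  refine Submodule.span_le.2 ?_
  rintro _ ⟨k, rfl⟩
  have hk : (fun h : G => A (a (h * (k : G))) * B (b (h * (k : G)))) = P (fun x : Gα => A (x * a (k : G))) (fun y : Gβ => B (y * b (k : G))) := by
    funext h
    rw [hP, map_mul, map_mul]
  show (fun h : G => A (a (h * (k : G))) * B (b (h * (k : G)))) ∈ _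
  rw [hk]
  exact Submodule.apply_mem_map₂ P (Submodule.subset_span ⟨k, rfl⟩) (Submodule.subset_span ⟨k, rfl⟩)

/-- **the «pull back and multiply» bilinear map** `(f, g) ↦ (h ↦ f(a h)·g(b h))` exists as an `R`-bilinear map. [folklore] -/
theorem exists_bilinear_mul_comp {R : Type*} [CommRing R] {G Gα Gβ : Type*} (a : G → Gα) (b : G → Gβ) :
    ∃ P : (Gα → R) →ₗ[R] (Gβ → R) →ₗ[R] (G → R), ∀ (f : Gα → R) (g : Gβ → R) (h : G), P f g h = f (a h) * g (b h) :=
  ⟨LinearMap.mk₂ R (fun f g => fun h => f (a h) * g (b h)) (fun _ _ _ => funext fun _ => by simp only [Pi.add_apply]; ring)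
      (fun _ _ _ => funext fun _ => by simp only [Pi.smul_apply, smul_eq_mul]; ring) (fun _ _ _ => funext fun _ => by simp only [Pi.add_apply]; ring)
      (fun _ _ _ => funext fun _ => by simp only [Pi.smul_apply, smul_eq_mul]; ring),
    fun _ _ _ => rfl⟩

/-- **finitely generated span of the translates of a product**: if the right translates of `A` along `a(K)` and of `B` along `b(K)` span finitely generated modules, so do the
right `K`-translates of `h ↦ A(a h)·B(b h)` (`Submodule.FG.map₂` + §1). [folklore] [cite: BorelJacquet1979, §4.1] -/
theorem fg_span_range_mul_comp {R : Type*} [CommRing R] {G Gα Gβ : Type*} [Group G] [Group Gα] [Group Gβ] (a : G →* Gα) (b : G →* Gβ) (A : Gα → R) (B : Gβ → R)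
    (K : Set G) (hA : (Submodule.span R (Set.range fun k : K => fun x : Gα => A (x * a (k : G)))).FG)
    (hB : (Submodule.span R (Set.range fun k : K => fun y : Gβ => B (y * b (k : G)))).FG) :
    ∃ W : Submodule R (G → R), W.FG ∧ Submodule.span R (Set.range fun k : K => fun h : G => A (a (h * (k : G))) * B (b (h * (k : G)))) ≤ W := by
  obtain ⟨P, hP⟩ := exists_bilinear_mul_comp (R := R) (a : G → Gα) (b : G → Gβ)
  exact ⟨_, Submodule.FG.map₂ P hA hB, span_range_mul_comp_le_map₂ a b A B K P hP⟩

/-- **finite-dimensional version** (division ring of scalars = a field `𝕜` here, since `map₂` wants commutative scalars): finite-dimensional factor spans ⇒ finite-dimensional span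
of the `K`-translates of the product. [folklore] [cite: BorelJacquet1979, §4.1] -/
theorem finiteDimensional_span_range_mul_comp {𝕜 : Type*} [Field 𝕜] {G Gα Gβ : Type*} [Group G] [Group Gα] [Group Gβ] (a : G →* Gα) (b : G →* Gβ) (A : Gα → 𝕜) (B : Gβ → 𝕜)
    (K : Set G) (hA : FiniteDimensional 𝕜 (Submodule.span 𝕜 (Set.range fun k : K => fun x : Gα => A (x * a (k : G)))))
    (hB : FiniteDimensional 𝕜 (Submodule.span 𝕜 (Set.range fun k : K => fun y : Gβ => B (y * b (k : G))))) :
    FiniteDimensional 𝕜 (Submodule.span 𝕜 (Set.range fun k : K => fun h : G => A (a (h * (k : G))) * B (b (h * (k : G))))) := by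
  obtain ⟨W, hW, hle⟩ := fg_span_range_mul_comp a b A B K (Module.Finite.iff_fg.1 hA) (Module.Finite.iff_fg.1 hB)
  haveI : FiniteDimensional 𝕜 W := Module.Finite.iff_fg.2 hW
  exact Submodule.finiteDimensional_of_le hle

/-- **open level over a compact set of translators ⇒ finite-dimensional span**, in the `Set.range` form of §1: if `B(y u) = B(y)` for `u` in an open subgroup and `b(K)` is
contained in a compact set, the translates `{y ↦ B(y · b k)}_{k ∈ K}` span a finite-dimensional space (★ p861127 §1). [folklore] [cite: BorelJacquet1979, §4.1] -/
theorem finiteDimensional_span_range_comp_of_isCompact {𝕜 : Type*} [Field 𝕜] {G Gβ : Type*} [Group G] [Group Gβ] [TopologicalSpace Gβ] [ContinuousMul Gβ] (b : G →* Gβ)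
    (B : Gβ → 𝕜) (U : Subgroup Gβ) (hU : IsOpen (U : Set Gβ)) (hB : ∀ y, ∀ u ∈ U, B (y * u) = B y) (K : Set G) {C : Set Gβ} (hC : IsCompact C) (hKC : ∀ k ∈ K, b k ∈ C) :
    FiniteDimensional 𝕜 (Submodule.span 𝕜 (Set.range fun k : K => fun y : Gβ => B (y * b (k : G)))) := by
  refine FiniteDimensional.span_of_finite 𝕜 ((finite_image_rightTranslate_of_isCompact U hU B hB hC).subset ?_)
  rintro _ ⟨k, rfl⟩
  exact ⟨b (k : G), hKC k k.2, rfl⟩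

variable (L : Type) [Field L] [NumberField L] [IsCMField L]
variable {N M n : ℕ} (e : Fin N × Fin M ≃ Fin n)
  (dV : Fin N → L) (hdV : ∀ i, IsCMField.complexConj L (dV i) = dV i)
  (dW : Fin M → L) (hdW : ∀ i, IsCMField.complexConj L (dW i) = dW i)

/-! ## §2 `K`-finiteness of `h ↦ A(h_∞)·B(h_f)` for ANY Iwasawa datum -/

/-- **(G-Kfin) AN ARCHIMEDEAN × FINITE PRODUCT OF OPEN FINITE LEVEL IS `K`-FINITE.**  `𝒦` any Iwasawa datum of `H(𝔸)` (compact `𝒦.K`); `A : H_∞ → ℂ` with the right translates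
`x ↦ A(x · k_∞)`, `k ∈ 𝒦.K`, spanning a finite-dimensional space; `B : H(𝔸_f) → ℂ` right-invariant under an OPEN subgroup `U_f ≤ H(𝔸_f)`.  Then `φ(h) := A(h_∞)·B(h_f)` is
`K`-finite: `IsKFinite 𝒦 φ` (★ D1′).  [cite: BorelJacquet1979, §4.1] [cite: HarrisKudlaSweet1996, §1 (1.16)] [cite: KudlaRallis1994, §1] -/
theorem isKFinite_archMul_fin (𝒦 : IwasawaDatum L e dV hdV dW hdW)
    (A : UnitaryGroup.arch (Fp L) L (IsCMField.complexConj L) (n + n) (hermD L e dV hdV dW hdW) → ℂ)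
    (B : UnitaryGroup.finAdelic (Fp L) L (IsCMField.complexConj L) (n + n) (hermD L e dV hdV dW hdW) → ℂ)
    (hA : FiniteDimensional ℂ (Submodule.span ℂ (Set.range fun k : 𝒦.K =>
      fun x : UnitaryGroup.arch (Fp L) L (IsCMField.complexConj L) (n + n) (hermD L e dV hdV dW hdW) =>
        A (x * UnitaryGroup.archPart (Fp L) L (IsCMField.complexConj L) (n + n) (hermD L e dV hdV dW hdW) (k : HA L e dV hdV dW hdW)))))
    {Uf : Subgroup (UnitaryGroup.finAdelic (Fp L) L (IsCMField.complexConj L) (n + n) (hermD L e dV hdV dW hdW))}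
    (hUf : IsOpen (Uf : Set (UnitaryGroup.finAdelic (Fp L) L (IsCMField.complexConj L) (n + n) (hermD L e dV hdV dW hdW))))
    (hB : ∀ y, ∀ u ∈ Uf, B (y * u) = B y) :
    Literature.NumberTheory.K2Lit.SiegelDoubled.IsKFinite 𝒦 (fun h : HA L e dV hdV dW hdW =>
      A (UnitaryGroup.archPart (Fp L) L (IsCMField.complexConj L) (n + n) (hermD L e dV hdV dW hdW) h) *
        B (UnitaryGroup.finPart (Fp L) L (IsCMField.complexConj L) (n + n) (hermD L e dV hdV dW hdW) h)) := by
  -- the finite factor: finitely many translates over the compact set `finPart(𝒦.K)`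
  have hB' := finiteDimensional_span_range_comp_of_isCompact (𝕜 := ℂ)
    (UnitaryGroup.finPart (Fp L) L (IsCMField.complexConj L) (n + n) (hermD L e dV hdV dW hdW)) B Uf hUf hB (𝒦.K : Set (HA L e dV hdV dW hdW))
    (𝒦.isCompact_K.image (UnitaryGroup.continuous_finPart (Fp L) L (IsCMField.complexConj L) (n + n) (hermD L e dV hdV dW hdW))) (fun k hk => ⟨k, hk, rfl⟩)
  unfold Literature.NumberTheory.K2Lit.SiegelDoubled.IsKFinite Literature.NumberTheory.K2Lit.SiegelDoubled.rightTranslateSpan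
  exact finiteDimensional_span_range_mul_comp (𝕜 := ℂ)
    (UnitaryGroup.archPart (Fp L) L (IsCMField.complexConj L) (n + n) (hermD L e dV hdV dW hdW))
    (UnitaryGroup.finPart (Fp L) L (IsCMField.complexConj L) (n + n) (hermD L e dV hdV dW hdW)) A B (𝒦.K : Set (HA L e dV hdV dW hdW)) hA hB'

/-- **continuity of the product**: `A` continuous and `B` of open level (hence locally constant, ★ p861068 §1) ⇒ `h ↦ A(h_∞)·B(h_f)` is continuous on `H(𝔸)` (★ U2
`continuous_archPart ∕ continuous_finPart`). [cite: BorelJacquet1979, §4.1] -/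
theorem continuous_archMul_fin
    {A : UnitaryGroup.arch (Fp L) L (IsCMField.complexConj L) (n + n) (hermD L e dV hdV dW hdW) → ℂ} (hAc : Continuous A)
    {B : UnitaryGroup.finAdelic (Fp L) L (IsCMField.complexConj L) (n + n) (hermD L e dV hdV dW hdW) → ℂ}
    {Uf : Subgroup (UnitaryGroup.finAdelic (Fp L) L (IsCMField.complexConj L) (n + n) (hermD L e dV hdV dW hdW))}
    (hUf : IsOpen (Uf : Set (UnitaryGroup.finAdelic (Fp L) L (IsCMField.complexConj L) (n + n) (hermD L e dV hdV dW hdW))))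
    (hB : ∀ y, ∀ u ∈ Uf, B (y * u) = B y) :
    Continuous (fun h : HA L e dV hdV dW hdW =>
      A (UnitaryGroup.archPart (Fp L) L (IsCMField.complexConj L) (n + n) (hermD L e dV hdV dW hdW) h) *
        B (UnitaryGroup.finPart (Fp L) L (IsCMField.complexConj L) (n + n) (hermD L e dV hdV dW hdW) h)) :=
  (hAc.comp (UnitaryGroup.continuous_archPart (Fp L) L (IsCMField.complexConj L) (n + n) (hermD L e dV hdV dW hdW))).mul
    ((continuous_of_forall_mul_eq Uf hUf B hB).comp (UnitaryGroup.continuous_finPart (Fp L) L (IsCMField.complexConj L) (n + n) (hermD L e dV hdV dW hdW)))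

/-! ## §3 Standard data: the archimedean input in the `IsArchKFinite` currency -/

/-- **(G-Kfin) FOR A STANDARD DATUM, ARCH INPUT = ★ `IsArchKFinite`**: `𝒦` STANDARD (★ J1(a) `IsStd`: `𝒦.K = C_∞·C_f`); `A : H_∞ → ℂ` `K_∞`-finite in the sense of ★ S2 DEFS
`IsArchKFinite 𝒦 A` (a finite-dimensional `V ∋ A` stable under `x ↦ f(x a)` for every arch `a` with `(a, 1) ∈ 𝒦.K`); `B` of open level `U_f ≤ H(𝔸_f)`.  Then `h ↦ A(h_∞)·B(h_f)` is
`K`-finite (for `k ∈ 𝒦.K` the element `(k_∞, 1)` lies in `𝒦.K`, ★ `IsStd.exists_arch`, so §2 applies). [cite: BorelJacquet1979, §4.1] [cite: Tan1999, §1 p. 166]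
[cite: HarrisKudlaSweet1996, §1 (1.15)–(1.17)] -/
theorem isKFinite_archMul_fin_of_isArchKFinite {𝒦 : IwasawaDatum L e dV hdV dW hdW} (h𝒦 : 𝒦.IsStd)
    {A : UnitaryGroup.arch (Fp L) L (IsCMField.complexConj L) (n + n) (hermD L e dV hdV dW hdW) → ℂ} (hA : IsArchKFinite L e dV hdV dW hdW 𝒦 A)
    (B : UnitaryGroup.finAdelic (Fp L) L (IsCMField.complexConj L) (n + n) (hermD L e dV hdV dW hdW) → ℂ)
    {Uf : Subgroup (UnitaryGroup.finAdelic (Fp L) L (IsCMField.complexConj L) (n + n) (hermD L e dV hdV dW hdW))}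
    (hUf : IsOpen (Uf : Set (UnitaryGroup.finAdelic (Fp L) L (IsCMField.complexConj L) (n + n) (hermD L e dV hdV dW hdW))))
    (hB : ∀ y, ∀ u ∈ Uf, B (y * u) = B y) :
    Literature.NumberTheory.K2Lit.SiegelDoubled.IsKFinite 𝒦 (fun h : HA L e dV hdV dW hdW =>
      A (UnitaryGroup.archPart (Fp L) L (IsCMField.complexConj L) (n + n) (hermD L e dV hdV dW hdW) h) *
        B (UnitaryGroup.finPart (Fp L) L (IsCMField.complexConj L) (n + n) (hermD L e dV hdV dW hdW) h)) := by
  obtain ⟨V, hVfd, hAV, hV⟩ := hA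
  haveI := hVfd
  obtain ⟨Cinf, S, -, -, hCK, hKC⟩ := h𝒦.exists_arch
  refine isKFinite_archMul_fin L e dV hdV dW hdW 𝒦 A B ?_ hUf hB
  refine Submodule.finiteDimensional_of_le (S₂ := V) (Submodule.span_le.2 ?_)
  rintro _ ⟨k, rfl⟩
  exact hV _ (hCK _ (hKC (k : HA L e dV hdV dW hdW) k.2)) A hAV

end Summit.HodgeConjecture.HodgeConjecture.Cruxes.HLiu418.K2LiuArchFinProductKFinite

end
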